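import Summits.ValiantsHypothesis.ValiantsHypothesis.Theses.FeketeSOS
import Literature.NumberTheory.LFunctions.FeketePolynomial
import Literature.RingTheory.Valuation.AlgClosedResidue

/-!
PUBLISHED VARIANT (r2-nobuild, 2026-08-16T08:40Z): identical to the lead's `work/FeketeBoundedFanin.lean` except that the three
LANDED stubs (`stub_placeReduction` p86809, `stub_wittFold` p87861, `stub_feketeExactOrder` p89145 — all ACCEPTED under
`Summits/ValiantsHypothesis/ValiantsHypothesis/Theorems/FeketeSOSFeketeBoundedFanin{PlaceReduction,WittFold,FeketeExactOrder}.lean`,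
namespace `Summit.ValiantsHypothesis.ValiantsHypothesis.Theorems.FeketeBoundedFaninWPU`) are written here with `sorry` instead of
`import` + `exact`, ONLY because the farm snapshot serving workfile elaboration has not yet built those modules ("stale:unbuilt").
They are CLOSED; the genuinely open stubs are `stub_sublinearShadowBounded` (A″) and `stub_charPSparseSOSBounded` (D″) of the
main composition (reshape r3 below: the bounded-fan-in specialisations of the route's cruxes stmt-14990 / stmt-14989), and,
feeding them by checked implications, this line's own `stub_depthDescent` (A1) and `stub_productGap` (D′).  Replace the three `sorry`s by
the imports + `exact Summit.ValiantsHypothesis.ValiantsHypothesis.Theorems.FeketeBoundedFaninWPU.<name>` as soon as the modules build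
(the import version is the lead's work/FeketeBoundedFanin.lean).

LEAD RESHAPE r2 (same seat, 2026-08-16, after A0/B/C LANDED as p86809/p87861/p89145): the planner's Stub D (UFA♯,
`stub_splitGap`, target-free gap with socle window) is replaced as the REGISTERED load-bearing stub by the strictly
weaker, target-specific `stub_productGap` (D′: `t ≤ t₀` products `≡ u·F̄_p`, `u ≠ 0` ⟹ `p³ ≤ (C₀·Σ|supp|)⁴`), which is
exactly what the composition consumes after (A)+(B); UFA♯ + the landed exact order ⟹ D′ is kept as the CHECKED theorem
`productGap_of_splitGap`, so the planner's route survives as a sufficient condition while a refutation of the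
registered stub is now crux-relevant (cheap two-product identities for `F̄_p` itself).  Stub C left the composition
(landed theorem `feketeExactOrder`, used inside `productGap_of_splitGap`).  Registered stubs now: 4 —
`stub_placeReduction` ✓, `stub_depthDescent` (open), `stub_wittFold` ✓, `stub_productGap` (open).  δ = 1/8, p₀ = M⁸.

LEAD RESHAPE r1 (prover-line-stmt-ValiantsHypothesis-3998-0, 2026-08-16): the planner's vehicle stub
`stub_nonCancellingReduction` (depth 0 provable + positive depth OPEN, in one signature) is split at the skeleton
level into the PROVABLE `stub_placeReduction` (a place `V ⊂ ℂ` above `p`, a Gauss–lattice basis `w ∈ V[X]^r` of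
`span(g_i)` with linearly independent reductions and supports inside `⋃ supp g_i`, and the NORMALISED identity
`Σ T_{jj'} w_j w_{j'} = μ·F_p` in `V[X]` with `μ = 1` (depth 0) or some `T_{jj'} = 1` (cancelling top layer)) and the
OPEN `stub_depthDescent` (such a normalised `V`-identity yields a non-cancelling residue identity with boundedly
many polynomials of comparable total support).  The sorry-free glue `nonCancellingReduction` below has VERBATIM the
old stub's signature (depth 0 is reduced in checked code via `Literature.RingTheory.Valuation.{charP_residueField,
isAlgClosed_residueField}`), so `FeketeBoundedFanin_of` is unchanged but for that one call.  Stubs now: 5.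

Original header (planner):
# `FeketeSOS.FeketeBoundedFanin` (stmt-ValiantsHypothesis-3998) — line `witt-pascal-ufa`

Checked skeleton (crux-plan, opening, round 1; planner-cruxplan-stmt-ValiantsHypothesis-3998-witt-pascal-ufa-0,
2026-08-16) for idea card `Cruxes/FeketeBoundedFanin/Ideas/witt-pascal-ufa.md` (ideator 2), with the triage
panel's mandatory repair (TRIAGE-r1-1 §witt-pascal-ufa "pass, with a mandatory repair"; r1-2 / r1-3: the
as-typed `UnipotentFewnomialABC C₀` is FALSE for every `C₀` by the socle tiling — landed as
`Theorems/FeketeBoundedFanin/Negative/UnipotentFewnomialABCFalse.lean` — and every residual statement of this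
crux must carry a SOCLE WINDOW and EXACT (two-sided) orders).

THE LINE.  Bounded top fan-in `s₀` is used twice: (1) a complex representation `Σ_{i<s₀} c_i g_i² = F_p`
reduces at a place of `ℂ` above `p` — in a Gauss-orthonormal basis of `W = span(g_i)`, descending through the
`𝔭`-adically cancelling layers if the Gram matrix is not `p`-integral — to a NON-CANCELLING characteristic-`p`
quadratic identity `Σ_{j,j'<d} T_{jj'} w_j w_{j'} ≡ u·F̄_p (mod X^p − 1)`, `u ≠ 0`, with `d ≤ D(s₀)` polynomials of
total support `≤ C(s₀)·Σ|supp g_i|` (`stub_nonCancellingReduction`: the depth-0 case is the card's provable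
`GaussOrthonormal` + `PlaceDichotomy`; positive depth is the card's Teichmüller-digit descent, OPEN);
(2) over the algebraically closed residue field the form is Witt-paired into `t = ⌈d/2⌉` PRODUCTS of two
polynomials each, folded to degree `< p` (`stub_wittFold`, provable).  Euler's criterion makes the target vanish
at the unipotent point `X = 1` to order EXACTLY `N = (p−1)/2` — a middle order (`stub_feketeExactOrder`,
Mináč–Nguyen–Tân Prop 5.1, provable), so the sum of `t` sparse products has exact order `N` at `1`.  The one new
load-bearing lemma, the card's UNIPOTENT FEWNOMIAL ABC in its repaired two-sided form UFA♯ (`stub_splitGap`):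
a sum of `t ≤ t₀` products of two polynomials of degree `< p` has exact `(X−1)`-order either `≤ C₀(t₀)·(total
number of monomials of the factors)` or `≥ p − 1 − B₀(t₀)` (the socle window, where the tilings
`X·G_a·G_b(X^a) + 1 = (X−1)^{p−1}`, their `ϑ`-derivatives and the Frobenius cheat `X^j·X^{p−j} − 1 = (X−1)^p` live).
At `m = N` the window is missed for `p > 2B₀ + 1`, so `(p−1)/2 ≤ C₀ · 2t · C(s₀) · Σ|supp g_i|`: a LINEAR bound,
hence the crux with `δ = 1/4` (`FeketeBoundedFanin_of`, kernel-checked: it calls the four registered stubs and nothing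
else carries a `sorry`; `FeketeBoundedFanin_proof` is the conventional alias).

Vocabulary: the tree's `Literature.NumberTheory.LFunctions.feketePolynomial p : ℤ[X]` mapped into the field at
hand — over `ℂ` this is LITERALLY the crux's inlined sum (`map_feketePolynomial_complex`); no new definition.
-/

namespace Summit.ValiantsHypothesis.ValiantsHypothesis.Cruxes.FeketeBoundedFanin.WittPascalUfa

open Polynomial Finset
open scoped BigOperators
open Literature.NumberTheory.LFunctions
open Summit.ValiantsHypothesis.ValiantsHypothesis.Theses

set_option linter.unusedVariables false
-- `Summit.ValiantsHypothesis.ValiantsHypothesis.…` is the tree's mandated single-conjunct layout (Sub = Summit).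
set_option linter.dupNamespace false

/-! ## The registered stubs (r1: A ↦ A0 `stub_placeReduction` + A1 `stub_depthDescent`; r2: D ↦ D′ `stub_productGap`, C landed and retired) -/

/-- **Stub A0 — LANDED (p86809, `…Theorems.FeketeBoundedFaninWPU.stub_placeReduction`; `sorry` below only for the unbuilt-module reason in the header) — reduction data at a place of `ℂ` above `p` in a Gauss–lattice basis.**
Every complex representation `Σ_{i<s} c_i g_i² = F_p` yields: a valuation subring `V ⊂ ℂ` with `p ∈ 𝔪_V`
(`Literature.RingTheory.Valuation.exists_valuationSubring_natCast_mem_maximalIdeal`); `r ≤ s` polynomials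
`w_j ∈ V[X]` whose reductions modulo `𝔪_V` are LINEARLY INDEPENDENT over the residue field and whose supports lie in
`⋃_i supp g_i` (the card's `GaussOrthonormal`: `W = span_ℂ(g_i)` has dimension `r ≤ s`; in the `r × U` coefficient
matrix of any basis pick an `r × r` minor of LARGEST valuation size; by Cramer every coordinate of the re-based rows
is a ratio of minors, hence in `V`, and the chosen minor becomes the identity, which survives reduction); a matrix
`T ∈ M_r(V)` and `μ ∈ V ∖ {0}` with the EXACT identity `Σ_{j,j'} T_{jj'} w_j w_{j'} = μ·F_p` in `V[X]`, NORMALISED: either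
`μ = 1` (the Gram matrix `T₀ = Aᵀ·diag(c)·A` of the representation in the basis `w`, `g_i = Σ_j A_{ij} w_j`, is
`V`-integral — depth 0) or some entry `T_{jj'} = 1` (divide `Σ T₀ w w = F_p` by the entry of `T₀` of largest size,
which is not in `V`; then `μ = ` its inverse `∈ 𝔪_V`).  This is the card's `PlaceDichotomy` with its output tied to
the GIVEN representation (no junk branch: the `w̄_j` are independent and `Σ T w w = μ F_p` holds on the nose). -/
theorem stub_placeReduction :
    ∀ (p : ℕ) [Fact p.Prime] (s : ℕ) (c : Fin s → ℂ) (g : Fin s → ℂ[X]),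
      (∑ i, C (c i) * g i ^ 2) = (feketePolynomial p).map (Int.castRingHom ℂ) →
      ∃ (V : ValuationSubring ℂ) (r : ℕ) (w : Fin r → V[X]) (T : Matrix (Fin r) (Fin r) V) (μ : V),
        ((p : ℕ) : V) ∈ IsLocalRing.maximalIdeal V ∧ r ≤ s ∧ μ ≠ 0 ∧ (μ = 1 ∨ ∃ j j', T j j' = 1) ∧
        LinearIndependent (IsLocalRing.ResidueField V)
          (fun j => (w j).map (IsLocalRing.residue V)) ∧
        (∀ j, ((w j).map (algebraMap V ℂ)).support ⊆ Finset.univ.biUnion fun i => (g i).support) ∧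
        (∑ j, ∑ j', C (T j j') * (w j * w j')) = C μ * (feketePolynomial p).map (Int.castRingHom V) := by
  sorry

/-- **Stub A1 — depth descent (OPEN; the second crux-sized stub).**  For every `s` there are `D = D(s)`,
`C = C(s)`: a normalised identity `Σ_{j,j'<r} T_{jj'} w_j w_{j'} = μ·F_p` in `V[X]` at a place `V ⊂ ℂ` above the odd
prime `p` (`r ≤ s`, `w̄_j` linearly independent over the residue field, `deg w_j ≤ p²`, `μ ≠ 0`, some `T_{jj'} = 1`)
yields over an algebraically closed field `K` of characteristic `p` at most `D` polynomials of total support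
`≤ C·Σ_j |supp w_j|`, a matrix `T'` and `u ≠ 0` with `Σ T'_{jj'} w'_j w'_{j'} ≡ u·F̄_p (mod X^p − 1)`.  If `μ` is a unit
this is immediate (reduce modulo `𝔪_V`, `u = μ̄`); the content is `μ ∈ 𝔪_V`: the top layer `Σ T̄ w̄ w̄ = 0` is an exactly
isotropic configuration of INDEPENDENT fewnomials, and one must descend (the card's Teichmüller-digit expansion
`w_j = Σ_k ϖ^k w_j^{(k)}`, every digit a fewnomial on `supp w_j`) to the first layer where `F̄_p` appears — a
non-cancelling identity with `O_s(e²)` terms at depth `e` — so a bound `e ≤ e(s)` uniform in `p` on the depth of SOME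
representation with the given supports is what is missing (= `DepthBranch` of card witt-jordan-staircase =
`NoForcedCancellation` of this card = `NonCancellingReduction` of card log-monomial-gap).  Why it might fail: forced
cancellation of unbounded depth (constituents congruent modulo `𝔭`; the Jacobi square `Ψ² ≡ J·F_p` has depth 1, the
Gauss-sum identity `Σ_j χ(j) U_p(ζ^j X) = G·F_p` has `v(G⁻¹) < 0` but unbounded fan-in).  The composition tolerates
`C(s)` up to `p^{1/4−ε}`; only `D(s)` must stay bounded. -/
theorem stub_depthDescent :
    ∀ s : ℕ, ∃ D Cs : ℕ, ∀ (p : ℕ) [Fact p.Prime], p ≠ 2 →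
      ∀ (V : ValuationSubring ℂ) (r : ℕ) (w : Fin r → V[X]) (T : Matrix (Fin r) (Fin r) V) (μ : V),
        ((p : ℕ) : V) ∈ IsLocalRing.maximalIdeal V → r ≤ s → μ ≠ 0 → (∃ j j', T j j' = 1) →
        LinearIndependent (IsLocalRing.ResidueField V)
          (fun j => (w j).map (IsLocalRing.residue V)) →
        (∀ j, (w j).natDegree ≤ p ^ 2) →
        (∑ j, ∑ j', C (T j j') * (w j * w j')) = C μ * (feketePolynomial p).map (Int.castRingHom V) →
        ∃ (K : Type) (_ : Field K) (_ : CharP K p) (_ : IsAlgClosed K) (d : ℕ)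
          (w' : Fin d → K[X]) (T' : Matrix (Fin d) (Fin d) K) (u : K),
          d ≤ D ∧ u ≠ 0 ∧ (∑ j, (w' j).support.card) ≤ Cs * ∑ j, (w j).support.card ∧
          (X ^ p - 1 : K[X]) ∣
            (∑ j, ∑ j', C (T' j j') * (w' j * w' j')) - C u * (feketePolynomial p).map (Int.castRingHom K) := by
  sorry

/-! ### Glue (sorry-free): A0 + A1 ⇒ the planner's non-cancelling reduction, verbatim signature -/

/-- The Fekete polynomial pushed along `ℤ → R → S` is the Fekete polynomial pushed along `ℤ → S`. [folklore] -/
theorem map_map_feketePolynomial' {R S : Type*} [CommRing R] [CommRing S] (p : ℕ) [Fact p.Prime]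
    (f : R →+* S) :
    ((feketePolynomial p).map (Int.castRingHom R)).map f = (feketePolynomial p).map (Int.castRingHom S) := by
  rw [Polynomial.map_map, RingHom.ext_int (f.comp (Int.castRingHom R)) (Int.castRingHom S)]

/-- **Non-cancelling reduction** (the planner's Stub A, now a THEOREM modulo `stub_placeReduction` and
`stub_depthDescent`): every complex bounded-fan-in representation of `F_p` has a non-cancelling characteristic-`p`
shadow with boundedly many polynomials and comparable total support.  Depth 0 (`μ = 1`) is reduced here in checked
code (residue field of `V`: characteristic `p` by `charP_residueField`, algebraically closed by
`isAlgClosed_residueField`); the cancelling case calls `stub_depthDescent`.  Constants: `D = s + D₁(s)`,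
`Cs = s + Cs₁(s)·s`. -/
theorem nonCancellingReduction :
    ∀ s : ℕ, ∃ D Cs : ℕ, ∀ (p : ℕ) [Fact p.Prime], p ≠ 2 →
      ∀ (c : Fin s → ℂ) (g : Fin s → ℂ[X]), (∀ i, (g i).natDegree ≤ p ^ 2) →
        (∑ i, C (c i) * g i ^ 2) = (feketePolynomial p).map (Int.castRingHom ℂ) →
        ∃ (K : Type) (_ : Field K) (_ : CharP K p) (_ : IsAlgClosed K) (d : ℕ)
          (w : Fin d → K[X]) (T : Matrix (Fin d) (Fin d) K) (u : K),
          d ≤ D ∧ u ≠ 0 ∧ (∑ j, (w j).support.card) ≤ Cs * ∑ i, (g i).support.card ∧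
          (X ^ p - 1 : K[X]) ∣
            (∑ j, ∑ j', C (T j j') * (w j * w j')) - C u * (feketePolynomial p).map (Int.castRingHom K) := by
  classical
  intro s
  obtain ⟨D₁, Cs₁, hA1⟩ := stub_depthDescent s
  refine ⟨s + D₁, s + Cs₁ * s, ?_⟩
  intro p _ hp2 c g hdeg hrep
  obtain ⟨V, r, w, T, μ, hpV, hrs, hμ, hnorm, hli, hsuppw, hidV⟩ := stub_placeReduction p s c g hrep
  -- bookkeeping: the union of the supports of the `g_i`
  set U : Finset ℕ := Finset.univ.biUnion fun i => (g i).support with hU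
  set G : ℕ := ∑ i, (g i).support.card with hG
  have hUcard : U.card ≤ G := Finset.card_biUnion_le
  have hιinj : Function.Injective (algebraMap V ℂ) := IsFractionRing.injective V ℂ
  have hsuppV : ∀ j, (w j).support = ((w j).map (algebraMap V ℂ)).support := fun j =>
    (support_map_of_injective (w j) hιinj).symm
  have hwcard : ∀ j, (w j).support.card ≤ G := fun j => by
    rw [hsuppV j]
    exact (Finset.card_le_card (hsuppw j)).trans hUcard
  have hWsum : (∑ j, (w j).support.card) ≤ s * G :=
    calc (∑ j, (w j).support.card) ≤ ∑ _j : Fin r, G := Finset.sum_le_sum fun j _ => hwcard j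
      _ = r * G := by rw [Finset.sum_const, Finset.card_univ, Fintype.card_fin, smul_eq_mul]
      _ ≤ s * G := Nat.mul_le_mul_right G hrs
  -- degrees of the `w_j` are at most `p²` (their supports lie in `⋃ supp g_i`)
  have hdegw : ∀ j, (w j).natDegree ≤ p ^ 2 := by
    intro j
    rw [← natDegree_map_eq_of_injective hιinj (w j), natDegree_le_iff_coeff_eq_zero]
    intro N hN
    by_contra hne
    have hmem : N ∈ ((w j).map (algebraMap V ℂ)).support := mem_support_iff.mpr hne
    have hNU : N ∈ U := hsuppw j hmem
    rw [hU, Finset.mem_biUnion] at hNU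
    obtain ⟨i, -, hi⟩ := hNU
    have h1 : N ≤ (g i).natDegree := le_natDegree_of_mem_supp N hi
    have h2 := hdeg i
    have h3 : (p : WithBot ℕ) ^ 2 = ((p ^ 2 : ℕ) : WithBot ℕ) := by push_cast; ring
    have hN' : p ^ 2 < N := by exact_mod_cast hN
    omega
  rcases hnorm with hμ1 | hT1
  · -- depth 0: reduce modulo `𝔪_V`
    haveI hchar : CharP (IsLocalRing.ResidueField V) p :=
      Literature.RingTheory.Valuation.charP_residueField V hpV
    have halg : IsAlgClosed (IsLocalRing.ResidueField V) :=
      Literature.RingTheory.Valuation.isAlgClosed_residueField V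
    set ρ : V →+* IsLocalRing.ResidueField V := IsLocalRing.residue V with hρ
    refine ⟨IsLocalRing.ResidueField V, inferInstance, hchar, halg, r, fun j => (w j).map ρ,
      fun j j' => ρ (T j j'), 1, by omega, one_ne_zero, ?_, ?_⟩
    · calc (∑ j, ((w j).map ρ).support.card) ≤ ∑ j, (w j).support.card :=
            Finset.sum_le_sum fun j _ => Finset.card_le_card (support_map_subset _ _)
        _ ≤ s * G := hWsum
        _ ≤ (s + Cs₁ * s) * G := Nat.mul_le_mul_right G (Nat.le_add_right s _)
    · refine ⟨0, ?_⟩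
      rw [mul_zero, sub_eq_zero]
      have h := congrArg (Polynomial.map ρ) hidV
      simp only [Polynomial.map_sum, Polynomial.map_mul, map_C] at h
      rw [map_map_feketePolynomial' p ρ, hμ1, map_one] at h
      exact h
  · -- cancelling top layer: the depth descent
    obtain ⟨K, iF, iC, iA, d, w', T', u, hdD, hu, hsupp', hdiv⟩ :=
      hA1 p hp2 V r w T μ hpV hrs hμ hT1 hli hdegw hidV
    refine ⟨K, iF, iC, iA, d, w', T', u, by omega, hu, ?_, hdiv⟩
    calc (∑ j, (w' j).support.card) ≤ Cs₁ * ∑ j, (w j).support.card := hsupp'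
      _ ≤ Cs₁ * (s * G) := Nat.mul_le_mul_left Cs₁ hWsum
      _ = (Cs₁ * s) * G := by ring
      _ ≤ (s + Cs₁ * s) * G := Nat.mul_le_mul_right G (Nat.le_add_left _ s)

/-- **Stub B — LANDED (p87861, `…Theorems.FeketeBoundedFaninWPU.stub_wittFold`; `sorry` below only for the unbuilt-module reason in the header) — Witt pairing + cyclic folding.**  Over an algebraically closed field `K` of odd
characteristic `p`, a quadratic expression `Σ_{j,j'<d} T_{jj'} w_j w_{j'}` is congruent modulo `X^p − 1` to a sum of
`t ≤ ⌈d/2⌉` PRODUCTS `A_l·B_l` of polynomials of degree `< p`, each factor having at most `Σ_j |supp w_j|`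
monomials.  Proof route: symmetrise `T` (`2` invertible), diagonalise the symmetric bilinear form by congruence
(`LinearMap.BilinForm.exists_orthogonal_basis`; new variables `v = P⁻¹w` are `K`-combinations of the `w_j`, so
`supp v_k ⊆ ⋃_j supp w_j`), Witt-pair `c₀v₀² + c₁v₁² = (a v₀ + i b v₁)(a v₀ − i b v₁)` (`a² = c₀`, `b² = c₁`,
`i² = −1`: `IsAlgClosed.exists_pow_nat_eq`), keep a lone `c v² = (a v)(a v)` for odd `d`, and fold every factor
`L ↦ L̃ := Σ_e L_e X^{e mod p}` (`deg L̃ < p`, `|supp L̃| ≤ |supp L| ≤ |⋃_j supp w_j| ≤ Σ_j |supp w_j|`,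
`X^p − 1 ∣ L − L̃`).  The card's `WittPair` is the `d = 2` heart. -/
theorem stub_wittFold :
    ∀ (K : Type) [Field K] [IsAlgClosed K] (p : ℕ) [Fact p.Prime] [CharP K p], p ≠ 2 →
      ∀ (d : ℕ) (w : Fin d → K[X]) (T : Matrix (Fin d) (Fin d) K),
        ∃ (t : ℕ) (A B : Fin t → K[X]), 2 * t ≤ d + 1 ∧
          (∀ l, (A l).natDegree < p ∧ (B l).natDegree < p) ∧
          (∀ l, (A l).support.card ≤ ∑ j, (w j).support.card ∧
                (B l).support.card ≤ ∑ j, (w j).support.card) ∧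
          (X ^ p - 1 : K[X]) ∣ (∑ j, ∑ j', C (T j j') * (w j * w j')) - ∑ l, A l * B l := by
  sorry

/-- **Stub C — LANDED (p89145, `…Theorems.FeketeBoundedFaninWPU.stub_feketeExactOrder`; `sorry` below only for the
unbuilt-module reason in the header) — Euler's criterion at the unipotent point: `(X − 1)^{(p−1)/2} ∥ F̄_p` in characteristic
`p`.**  After reshape r2 it is used only inside the checked sufficient condition `productGap_of_splitGap` (the planner's UFA♯
route to Stub D′), not in the composition. -/
theorem stub_feketeExactOrder :
    ∀ (K : Type) [Field K] (p : ℕ) [Fact p.Prime] [CharP K p], p ≠ 2 →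
      (X - C 1 : K[X]) ^ ((p - 1) / 2) ∣ (feketePolynomial p).map (Int.castRingHom K) ∧
      ¬ (X - C 1 : K[X]) ^ ((p - 1) / 2 + 1) ∣ (feketePolynomial p).map (Int.castRingHom K) := by
  sorry

/-- **Stub D′ — PRODUCT GAP for the Fekete target (OPEN; the load-bearing lemma; lead reshape r2).**  For every `t₀`
there is `C₀ = C₀(t₀)` such that over any field `K` of characteristic `p`: if `t ≤ t₀` products of two polynomials of
degree `< p` represent a NON-ZERO multiple of the reduced Fekete polynomial cyclically,
`X^p − 1 ∣ Σ_{l<t} A_l B_l − u·F̄_p`, `u ≠ 0`, then the total number of monomials `Σ_l (|supp A_l| + |supp B_l|)`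
is at least `p^{3/4}/C₀` (typed in `ℕ` as `p³ ≤ (C₀·Σ)⁴`).  This is EXACTLY what the composition needs after
(A) reduction and (B) Witt pairing, and nothing more: it is the bounded-fan-in, products form of the route's
characteristic-`p` shadow crux `FeketeSOS.CharPSparseSOS` (stmt-14989: `s ≤ p^δ` squares, `Σ|supp| ≥ p^{1/2+δ}`)
— `t` products are `2t` squares `AB = ¼(A+B)² − ¼(A−B)²` and conversely (stub B) — i.e. `C⁺(t)` =
`MonomialProductBound t` (card log-monomial-gap) = `NCBranch` at any `η > 1/2` (card witt-jordan-staircase) =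
`CharPNonCancelling` (this card), with the exponent relaxed from linear to `3/4` (any exponent `> 1/2` closes the
crux; linear `p ≤ C₀·Σ` is what all measurements show: minima `≈ 0.65–0.77·p`, Disproof §C, kit j010281 /
j011521 / j011522).  It is IMPLIED by the planner's UFA♯ (`stub_splitGap` of reshape r1) together with the exact order
`(X−1)^{(p−1)/2} ∥ F̄_p` (landed): see the checked `productGap_of_splitGap` below; it is strictly weaker (one target,
one order `N = (p−1)/2`, and the full identity above order `N` is available to a prover: all Taylor coefficients of
`Σ A_l B_l` at `X = 1` are those of `u·F̄_p`, `p − 1` conditions instead of `N`).  `t = 1` is the sibling crux's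
landed result (`|supp A| + |supp B| ≥ (p+3)/2`, FeketeNoSparseSplitCyclic).  FIRST OPEN CASE: `t = 2`
(= `s₀ ∈ {3, 4}` of the crux at depth 0).  Why it might fail: a structured two-product identity for `F̄_p`
(Gauss-period / digit / PTE-type) of cost `o(p^{3/4})`; none known; in the coefficient-function picture
(`x ↦ [X^x]`, cyclic convolution `⊛` on `ℤ/p`) it says `a₁ ⊛ b₁ + a₂ ⊛ b₂ = u·χ_p` forces `Σ|supp| ≥ p^{3/4}/C₀`. -/
theorem stub_productGap :
    ∀ t₀ : ℕ, ∃ C₀ : ℕ, ∀ (K : Type) [Field K] (p : ℕ) [Fact p.Prime] [CharP K p] (t : ℕ), t ≤ t₀ →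
      ∀ (A B : Fin t → K[X]) (u : K), u ≠ 0 → (∀ l, (A l).natDegree < p ∧ (B l).natDegree < p) →
        (X ^ p - 1 : K[X]) ∣ (∑ l, A l * B l) - C u * (feketePolynomial p).map (Int.castRingHom K) →
        p ^ 3 ≤ (C₀ * ∑ l, ((A l).support.card + (B l).support.card)) ^ 4 := by
  sorry

/-! ### The planner's route to D′ (checked): UFA♯ + exact order ⟹ product gap -/

/-- **UFA♯ ⟹ D′.**  The planner's load-bearing statement of reshape r1 (`stub_splitGap`, the repaired unipotent
fewnomial abc with socle window — NOT registered any more, kept here as a hypothesis) implies `stub_productGap` with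
`C₀' = 2C₀ + 2B₀ + 3`: `X^p − 1 = (X−1)^p` and `u ≠ 0` transfer the exact order `N = (p−1)/2` of `F̄_p`
(`feketeExactOrder`) to `S = Σ A_l B_l`; UFA♯ at `m = N` gives `N ≤ C₀·Σ` or `p ≤ N + B₀ + 1`, i.e. `p ≤ (2C₀+2)·Σ`
or `p ≤ 2B₀ + 1`, and `Σ ≥ 1` because `S ≢ 0`. -/
theorem productGap_of_splitGap
    (hgap : ∀ t₀ : ℕ, ∃ C₀ B₀ : ℕ, ∀ (K : Type) [Field K] (p : ℕ) [Fact p.Prime] [CharP K p] (t : ℕ), t ≤ t₀ →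
      ∀ (A B : Fin t → K[X]) (m : ℕ), (∀ l, (A l).natDegree < p ∧ (B l).natDegree < p) →
        (X - C 1 : K[X]) ^ m ∣ ∑ l, A l * B l → ¬ (X - C 1 : K[X]) ^ (m + 1) ∣ ∑ l, A l * B l →
        m ≤ C₀ * ∑ l, ((A l).support.card + (B l).support.card) ∨ p ≤ m + B₀ + 1) :
    ∀ t₀ : ℕ, ∃ C₀ : ℕ, ∀ (K : Type) [Field K] (p : ℕ) [Fact p.Prime] [CharP K p] (t : ℕ), t ≤ t₀ →
      ∀ (A B : Fin t → K[X]) (u : K), u ≠ 0 → (∀ l, (A l).natDegree < p ∧ (B l).natDegree < p) →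
        (X ^ p - 1 : K[X]) ∣ (∑ l, A l * B l) - C u * (feketePolynomial p).map (Int.castRingHom K) →
        p ^ 3 ≤ (C₀ * ∑ l, ((A l).support.card + (B l).support.card)) ^ 4 := by
  intro t₀
  obtain ⟨C₀, B₀, hD⟩ := hgap t₀
  refine ⟨2 * C₀ + 2 * B₀ + 3, ?_⟩
  intro K _ p _ _ t ht A B u hu hdegAB hdivS
  have hprime : p.Prime := Fact.out
  set F : K[X] := (feketePolynomial p).map (Int.castRingHom K) with hF
  set S : K[X] := ∑ l, A l * B l with hS
  set N : ℕ := (p - 1) / 2 with hN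
  set Tot : ℕ := ∑ l, ((A l).support.card + (B l).support.card) with hTot
  -- `X^p - 1 = (X - 1)^p`
  have hXp : (X - C (1 : K)) ^ p = X ^ p - 1 := by
    rw [sub_pow_char, ← C_pow, one_pow, C_1]
  rw [← hXp] at hdivS
  -- `F̄_p ≠ 0` (coefficient of `X¹` is `(1|p) = 1`)
  have hF0 : F ≠ 0 := fun h => by
    have h1 : F.coeff 1 = 0 := by rw [h, coeff_zero]
    rw [hF, coeff_map, coeff_feketePolynomial_of_lt p hprime.one_lt, Nat.cast_one,
      legendreSym.at_one, map_one] at h1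
    exact one_ne_zero h1
  have hCu : IsUnit (C u) := isUnit_C.mpr (isUnit_iff_ne_zero.mpr hu)
  -- `Tot ≥ 1`: otherwise `S = 0` and `(X-1)^p ∣ u F̄_p`, impossible in degree `< p`
  have hTot1 : 1 ≤ Tot := by
    by_contra h0
    have hTot0 : Tot = 0 := by omega
    have hAl : ∀ l, A l = 0 := by
      intro l
      have hl : (A l).support.card + (B l).support.card = 0 := by
        have := Finset.single_le_sum (f := fun l => (A l).support.card + (B l).support.card)
          (fun l _ => Nat.zero_le _) (Finset.mem_univ l)
        omega
      have : (A l).support.card = 0 := by omega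
      simpa using this
    have hS0 : S = 0 := by
      rw [hS]; exact Finset.sum_eq_zero fun l _ => by rw [hAl l, zero_mul]
    have hdvdF : (X - C (1 : K)) ^ p ∣ C u * F := by
      have h := hdivS
      rw [hS0, zero_sub, dvd_neg] at h
      exact h
    have hdvdF' : (X - C (1 : K)) ^ p ∣ F := hCu.dvd_mul_left.mp hdvdF
    have hdeg := natDegree_le_of_dvd hdvdF' hF0
    rw [natDegree_pow, natDegree_X_sub_C, mul_one] at hdeg
    have hFdeg : F.natDegree ≤ p - 1 := by
      rw [hF]; exact (natDegree_map_le).trans (natDegree_feketePolynomial p).le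
    have := hprime.two_le
    omega
  by_cases hp2 : p = 2
  · -- tiny prime: absorbed by the constant
    subst hp2
    calc 2 ^ 3 ≤ 3 ^ 4 := by norm_num
      _ ≤ ((2 * C₀ + 2 * B₀ + 3) * Tot) ^ 4 := Nat.pow_le_pow_left (by nlinarith) 4
  -- exact order `N` of `F̄_p`, transferred to `S`
  obtain ⟨hFN, hFN1⟩ := stub_feketeExactOrder K p hp2
  have hNp : N ≤ p := by omega
  have hN1p : N + 1 ≤ p := by have := hprime.two_le; omega
  have hSN : (X - C (1 : K)) ^ N ∣ S := by
    have h1 : (X - C (1 : K)) ^ N ∣ S - C u * F := (pow_dvd_pow _ hNp).trans hdivS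
    have h2 : (X - C (1 : K)) ^ N ∣ C u * F := dvd_mul_of_dvd_right hFN _
    have h3 := dvd_add h1 h2
    rwa [sub_add_cancel] at h3
  have hSN1 : ¬ (X - C (1 : K)) ^ (N + 1) ∣ S := by
    intro h
    have h1 : (X - C (1 : K)) ^ (N + 1) ∣ S - C u * F := (pow_dvd_pow _ hN1p).trans hdivS
    have h3 : (X - C (1 : K)) ^ (N + 1) ∣ C u * F := by
      have h4 := dvd_sub h h1
      rwa [sub_sub_cancel] at h4
    exact hFN1 (hCu.dvd_mul_left.mp h3)
  have hgap' := hD K p t ht A B N hdegAB hSN hSN1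
  rw [← hTot] at hgap'
  -- both branches give `p ≤ (2C₀ + 2B₀ + 3) · Tot`
  have hpTot : p ≤ (2 * C₀ + 2 * B₀ + 3) * Tot := by
    rcases hgap' with h | h
    · have h1 : p ≤ 2 * (C₀ * Tot) + 2 := by omega
      nlinarith
    · have h1 : p ≤ 2 * B₀ + 1 := by omega
      nlinarith
  calc p ^ 3 ≤ ((2 * C₀ + 2 * B₀ + 3) * Tot) ^ 3 := Nat.pow_le_pow_left hpTot 3
    _ ≤ ((2 * C₀ + 2 * B₀ + 3) * Tot) ^ 4 :=
        Nat.pow_le_pow_right (Nat.mul_pos (by omega) (by omega)) (by norm_num)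

/-! ## Reshape r3 (lead, 2026-08-16T09Z): the two ROUTE-ALIGNED minimal stubs

After route rev 2 the load-bearing statements of this machinery live in the route as the cruxes `FeketeSOS.SublinearShadow`
(stmt-14990, de-bordering at a place above `p`, uniform in `s`) and `FeketeSOS.CharPSparseSOS` (stmt-14989, the
characteristic-`p` shadow, `s ≤ p^δ` squares).  The two stubs below are their BOUNDED-FAN-IN specialisations, typed so that
(i) each is implied at once by the corresponding route item (take `A := (s+1)^{A₀}`, resp. the same `δ` and
`p₀' = max(p₀, ⌈s₁^{1/δ}⌉)`), (ii) each is implied by this line's own stubs (A0 + A1 + B ⟹ `stub_sublinearShadowBounded`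
without the cheapness hypothesis; D′ + B ⟹ `stub_charPSparseSOSBounded` with `δ = 1/8`, see `charPSparseSOSBounded_of_productGap`),
and (iii) together they close the crux by pure bookkeeping (`FeketeBoundedFanin_of`, main composition, no Witt pairing needed:
squares in, squares out).  They are the weakest statements this line knows how to use. -/

/-- **Stub A″ — bounded sublinear shadow (OPEN; = `FeketeSOS.SublinearShadow` (stmt-14990) at fixed fan-in `s`).**  For every
`s` there are `A = A(s)`, `p₁ = p₁(s)` such that every CHEAP complex representation `Σ_{i<s} c_i g_i² = F_p` (`deg g_i ≤ p²`,
support-sum `G` with `G⁴ ≤ p³`) has a characteristic-`p` shadow: a field `K` of characteristic `p`, `d ≤ A` squares of polynomials of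
degree `< p` with total support `≤ A·G` and `X^p − 1 ∣ Σ c'_j g'_j² − F̄_p`.  Depth 0 is `stub_placeReduction` (landed) + reduction;
positive depth is `stub_depthDescent` (A1): A0 + A1 + `stub_wittFold` give this WITHOUT the cheapness hypothesis (products
`AB = ¼(A+B)² − ¼(A−B)²`, divide by `u`).  Implied verbatim by stmt-14990 with `A = (s+1)^{A₀}`. -/
theorem stub_sublinearShadowBounded :
    ∀ s : ℕ, ∃ A p₁ : ℕ, ∀ (p : ℕ) [Fact p.Prime], p₁ ≤ p →
      ∀ (c : Fin s → ℂ) (g : Fin s → ℂ[X]), (∀ i, (g i).natDegree ≤ p ^ 2) →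
        (∑ i, (g i).support.card) ^ 4 ≤ p ^ 3 →
        (∑ i, C (c i) * g i ^ 2) = (feketePolynomial p).map (Int.castRingHom ℂ) →
        ∃ (K : Type) (_ : Field K) (_ : CharP K p) (d : ℕ) (c' : Fin d → K) (g' : Fin d → K[X]),
          d ≤ A ∧ (∀ j, (g' j).natDegree < p) ∧
          (∑ j, (g' j).support.card) ≤ A * ∑ i, (g i).support.card ∧
          (X ^ p - 1 : K[X]) ∣ (∑ j, C (c' j) * g' j ^ 2) - (feketePolynomial p).map (Int.castRingHom K) := by
  sorry

/-- **Stub D″ — bounded characteristic-`p` sparse-SOS bound (OPEN; = `FeketeSOS.CharPSparseSOS` (stmt-14989) at fixed fan-in).**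
For every `s₁` there are `δ = δ(s₁) > 0` and `p₀` such that for primes `p ≥ p₀`, over any field `K` of characteristic `p`, every
cyclic representation `X^p − 1 ∣ Σ_{j<d} c_j g_j² − F̄_p` with `d ≤ s₁` squares of degree `< p` has `Σ_j |supp g_j| ≥ p^{1/2+δ}`.
First open case `d ∈ {3, 4}` (`d ≤ 2` is the sibling crux's landed `(p+3)/2`); implied by this line's D′ (`stub_productGap`) with
`δ = 1/8` via Witt pairing over `K̄` (`charPSparseSOSBounded_of_productGap`), hence by the planner's UFA♯; implied verbatim by
stmt-14989 (`p₀' = max(p₀, ⌈s₁^{1/δ}⌉)`).  All measurements (Disproof §C, triage jobs, this seat's j015431): minima `≈ 0.57–0.94·p`. -/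
theorem stub_charPSparseSOSBounded :
    ∀ s₁ : ℕ, ∃ δ : ℝ, 0 < δ ∧ ∃ p₀ : ℕ, ∀ (p : ℕ) [Fact p.Prime], p₀ ≤ p →
      ∀ (K : Type) [Field K] [CharP K p] (d : ℕ), d ≤ s₁ → ∀ (c : Fin d → K) (g : Fin d → K[X]),
        (∀ j, (g j).natDegree < p) →
        (X ^ p - 1 : K[X]) ∣ (∑ j, C (c j) * g j ^ 2) - (feketePolynomial p).map (Int.castRingHom K) →
        (p : ℝ) ^ (1 / 2 + δ) ≤ ∑ j, ((g j).support.card : ℝ) := by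
  sorry

/-! ## The main composition (kernel-checked; no `sorry` below this line except inside the alternative route's stubs) -/

/-- **The crux from the two route-aligned stubs** (`stub_sublinearShadowBounded` + `stub_charPSparseSOSBounded`; direct style:
concludes `FeketeSOS.FeketeBoundedFanin` BY NAME, no hypotheses).  With `A, p₁` from A″ at `s₀` and `δ, p₀` from D″ at `s₁ = A`:
`δ' = min(δ/2, 1/4)`, threshold `max(p₀, p₁, ⌈(A+1)^{2/δ}⌉, 2)`.  If `G⁴ > p³` then `G > p^{3/4} ≥ p^{1/2+δ'}`; otherwise A″ gives a
characteristic-`p` representation with `d ≤ A` squares of total support `≤ A·G`, D″ gives `p^{1/2+δ} ≤ A·G ≤ p^{δ/2}·G`, so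
`G ≥ p^{1/2+δ/2} ≥ p^{1/2+δ'}`. -/
theorem FeketeBoundedFanin_of : FeketeSOS.FeketeBoundedFanin := by
  intro s₀
  obtain ⟨A, p₁, hA⟩ := stub_sublinearShadowBounded s₀
  obtain ⟨δ, hδ, p₀, hD⟩ := stub_charPSparseSOSBounded A
  obtain ⟨δ', hδ'⟩ : ∃ δ' : ℝ, δ' = min (δ / 2) (1 / 4) := ⟨_, rfl⟩
  have hδ'pos : 0 < δ' := by rw [hδ']; exact lt_min (by linarith) (by norm_num)
  have hδ'1 : δ' ≤ δ / 2 := by rw [hδ']; exact min_le_left _ _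
  have hδ'2 : δ' ≤ 1 / 4 := by rw [hδ']; exact min_le_right _ _
  obtain ⟨p₂, hp₂⟩ : ∃ p₂ : ℕ, ((A : ℝ) + 1) ^ (2 / δ) ≤ (p₂ : ℝ) := ⟨⌈((A : ℝ) + 1) ^ (2 / δ)⌉₊, Nat.le_ceil _⟩
  refine ⟨δ', hδ'pos, max (max p₀ p₁) p₂, ?_⟩
  intro p _ hp c g hdeg hrep
  have hprime : p.Prime := Fact.out
  have hp0 : p₀ ≤ p := (le_max_left _ _).trans ((le_max_left _ _).trans hp)
  have hp1 : p₁ ≤ p := (le_max_right _ _).trans ((le_max_left _ _).trans hp)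
  have hp2' : p₂ ≤ p := (le_max_right _ _).trans hp
  obtain ⟨G, hG⟩ : ∃ G : ℕ, G = ∑ i, (g i).support.card := ⟨_, rfl⟩
  have hGreal : ((G : ℕ) : ℝ) = ∑ i, ((g i).support.card : ℝ) := by rw [hG, Nat.cast_sum]
  rw [← hGreal]
  have hp_pos : (0 : ℝ) < (p : ℝ) := Nat.cast_pos.mpr hprime.pos
  have hp1r : (1 : ℝ) ≤ (p : ℝ) := by exact_mod_cast hprime.one_lt.le
  have hG0 : (0 : ℝ) ≤ (G : ℝ) := Nat.cast_nonneg G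
  by_cases hcheap : G ^ 4 ≤ p ^ 3
  · -- cheap representation: characteristic-p shadow (A″), then the sparse-SOS bound (D″)
    have hrep' : (∑ i, C (c i) * g i ^ 2) = (feketePolynomial p).map (Int.castRingHom ℂ) :=
      hrep.trans (map_feketePolynomial_complex p).symm
    rw [hG] at hcheap
    obtain ⟨K, iF, iC, d, c', g', hdA, hdeg', hsupp', hdvd'⟩ := hA p hp1 c g hdeg hcheap hrep'
    have hbound := hD p hp0 K d hdA c' g' hdeg' hdvd'
    rw [← hG] at hsupp'
    have hsuppR : (∑ j, ((g' j).support.card : ℝ)) ≤ (A : ℝ) * (G : ℝ) := by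
      have h := (Nat.cast_le (α := ℝ)).mpr hsupp'
      rwa [Nat.cast_sum, Nat.cast_mul] at h
    have hA1 : (A : ℝ) + 1 ≤ (p : ℝ) ^ (δ / 2) := by
      have hA0 : (0 : ℝ) ≤ (A : ℝ) + 1 := by positivity
      have h1 : (((A : ℝ) + 1) ^ (2 / δ)) ^ (δ / 2) = (A : ℝ) + 1 := by
        rw [← Real.rpow_mul hA0]
        rw [show (2 / δ) * (δ / 2) = (1 : ℝ) by field_simp]
        exact Real.rpow_one _
      rw [← h1]
      have hp2R : ((A : ℝ) + 1) ^ (2 / δ) ≤ (p : ℝ) := hp₂.trans (by exact_mod_cast hp2')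
      exact Real.rpow_le_rpow (Real.rpow_nonneg hA0 _) hp2R (by linarith)
    have hmain : (p : ℝ) ^ (1 / 2 + δ) ≤ (p : ℝ) ^ (δ / 2) * (G : ℝ) := by
      calc (p : ℝ) ^ (1 / 2 + δ) ≤ ∑ j, ((g' j).support.card : ℝ) := hbound
        _ ≤ (A : ℝ) * (G : ℝ) := hsuppR
        _ ≤ ((A : ℝ) + 1) * (G : ℝ) := mul_le_mul_of_nonneg_right (by linarith) hG0
        _ ≤ (p : ℝ) ^ (δ / 2) * (G : ℝ) := mul_le_mul_of_nonneg_right hA1 hG0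
    have hsplit : (p : ℝ) ^ (1 / 2 + δ) = (p : ℝ) ^ (δ / 2) * (p : ℝ) ^ (1 / 2 + δ / 2) := by
      rw [← Real.rpow_add hp_pos]
      congr 1
      ring
    have hpow_pos : (0 : ℝ) < (p : ℝ) ^ (δ / 2) := Real.rpow_pos_of_pos hp_pos _
    have hG1 : (p : ℝ) ^ (1 / 2 + δ / 2) ≤ (G : ℝ) := by
      rw [hsplit] at hmain
      exact le_of_mul_le_mul_left hmain hpow_pos
    calc (p : ℝ) ^ (1 / 2 + δ') ≤ (p : ℝ) ^ (1 / 2 + δ / 2) :=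
          Real.rpow_le_rpow_of_exponent_le hp1r (by linarith)
      _ ≤ (G : ℝ) := hG1
  · -- expensive representation: `G⁴ > p³` already exceeds the claim
    have hlt : p ^ 3 < G ^ 4 := Nat.lt_of_not_le hcheap
    have hR : (p : ℝ) ^ (3 : ℕ) < (G : ℝ) ^ (4 : ℕ) := by
      have h := (Nat.cast_lt (α := ℝ)).mpr hlt
      rwa [Nat.cast_pow, Nat.cast_pow] at h
    have h34 : (p : ℝ) ^ (3 / 4 : ℝ) ≤ (G : ℝ) := by
      have h1 : ((G : ℝ) ^ (4 : ℕ)) ^ (1 / 4 : ℝ) = (G : ℝ) := by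
        rw [show (1 / 4 : ℝ) = ((4 : ℕ) : ℝ)⁻¹ by norm_num]
        exact Real.pow_rpow_inv_natCast hG0 (by norm_num)
      have h2 : ((p : ℝ) ^ (3 : ℕ)) ^ (1 / 4 : ℝ) = (p : ℝ) ^ (3 / 4 : ℝ) := by
        rw [← Real.rpow_natCast (p : ℝ) 3, ← Real.rpow_mul hp_pos.le]
        rw [show ((3 : ℕ) : ℝ) * (1 / 4 : ℝ) = 3 / 4 by norm_num]
      rw [← h1, ← h2]
      exact Real.rpow_le_rpow (pow_nonneg hp_pos.le 3) hR.le (by norm_num)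
    calc (p : ℝ) ^ (1 / 2 + δ') ≤ (p : ℝ) ^ (3 / 4 : ℝ) :=
          Real.rpow_le_rpow_of_exponent_le hp1r (by linarith)
      _ ≤ (G : ℝ) := h34

/-! ## The crux is a corollary of the route's thesis X (checked): `FeketeSOSHard → FeketeBoundedFanin` -/

/-- **X ⟹ crux.**  `FeketeSOS.FeketeSOSHard` (stmt-3996: `s ≤ p^δ` squares) implies `FeketeBoundedFanin` (fixed `s₀`): take the
same `δ` and `p₀' = max(p₀, ⌈s₀^{1/δ}⌉)`, so that `s₀ ≤ p^δ` for `p ≥ p₀'`.  (Route rev 2 records 3998 as a support item,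
"necessary condition of X"; this is the checked form of that remark, and the reason the lead's outcome is `blocked-on` X.) -/
theorem FeketeBoundedFanin_of_feketeSOSHard (hX : FeketeSOS.FeketeSOSHard) : FeketeSOS.FeketeBoundedFanin := by
  intro s₀
  obtain ⟨δ, hδ, p₀, h⟩ := hX
  obtain ⟨p₂, hp₂⟩ : ∃ p₂ : ℕ, ((s₀ : ℝ)) ^ (1 / δ) ≤ (p₂ : ℝ) := ⟨⌈((s₀ : ℝ)) ^ (1 / δ)⌉₊, Nat.le_ceil _⟩
  refine ⟨δ, hδ, max p₀ p₂, ?_⟩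
  intro p _ hp c g hdeg hrep
  have hp0 : p₀ ≤ p := (le_max_left _ _).trans hp
  have hp2 : p₂ ≤ p := (le_max_right _ _).trans hp
  have hs : (s₀ : ℝ) ≤ (p : ℝ) ^ δ := by
    have hs0 : (0 : ℝ) ≤ (s₀ : ℝ) := Nat.cast_nonneg _
    have h1 : (((s₀ : ℝ)) ^ (1 / δ)) ^ δ = (s₀ : ℝ) := by
      rw [← Real.rpow_mul hs0, show (1 / δ) * δ = (1 : ℝ) by field_simp, Real.rpow_one]
    rw [← h1]
    exact Real.rpow_le_rpow (Real.rpow_nonneg hs0 _) (hp₂.trans (by exact_mod_cast hp2)) hδ.le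
  exact h p hp0 s₀ c g hs hdeg hrep

/-! ## This line's stubs feed the main composition (checked): A0 + A1 + B ⟹ A″ and D′ + B ⟹ D″ -/

/-- Off-diagonal bookkeeping: for a diagonal matrix the quadratic expression is the weighted sum of squares. [folklore] -/
theorem sum_sum_diagonal_eq {K : Type} [Field K] {d : ℕ} (c : Fin d → K) (w : Fin d → K[X]) :
    (∑ j, ∑ j', C (Matrix.diagonal c j j') * (w j * w j')) = ∑ j, C (c j) * w j ^ 2 := by
  refine Finset.sum_congr rfl fun j _ => ?_
  rw [Finset.sum_eq_single j]
  · rw [Matrix.diagonal_apply_eq, pow_two]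
  · intro j' _ hne
    rw [Matrix.diagonal_apply_ne _ (Ne.symm hne), map_zero, zero_mul]
  · intro h; exact absurd (Finset.mem_univ j) h

/-- Products are differences of two squares: `Σ_l A_l B_l = Σ_l (¼(A_l+B_l)² − ¼(A_l−B_l)²)`, written over `Fin (t + t)` with
`Fin.append`; needs `4 ≠ 0`. [folklore] -/
theorem sum_mul_eq_sum_append_sq {K : Type} [Field K] (h4 : (4 : K) ≠ 0) {t : ℕ} (A B : Fin t → K[X]) (v : K) :
    (∑ j, C (Fin.append (fun _ : Fin t => v * 4⁻¹) (fun _ : Fin t => -(v * 4⁻¹)) j) *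
        (Fin.append (fun l => A l + B l) (fun l => A l - B l) j) ^ 2)
      = C v * ∑ l, A l * B l := by
  rw [Fin.sum_univ_add]
  simp only [Fin.append_left, Fin.append_right]
  rw [Finset.mul_sum, ← Finset.sum_add_distrib]
  refine Finset.sum_congr rfl fun l _ => ?_
  have h : C (v * 4⁻¹) * (4 : K[X]) = C v := by
    rw [← C_ofNat, ← map_mul, mul_assoc, inv_mul_cancel₀ h4, mul_one]
  rw [map_neg]
  linear_combination (A l * B l) * h

/-- **A0 + A1 + B ⟹ A″** (indeed without the cheapness hypothesis): the non-cancelling reduction (`nonCancellingReduction`, i.e.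
`stub_placeReduction` ✓ + `stub_depthDescent`) followed by Witt pairing (`stub_wittFold` ✓) and `AB = ¼(A+B)² − ¼(A−B)²`, divided by
`u`, is a characteristic-`p` representation by `≤ D+1` squares of degree `< p` and total support `≤ 2(D+1)·Cs·G`. -/
theorem sublinearShadowBounded_of_line :
    ∀ s : ℕ, ∃ A p₁ : ℕ, ∀ (p : ℕ) [Fact p.Prime], p₁ ≤ p →
      ∀ (c : Fin s → ℂ) (g : Fin s → ℂ[X]), (∀ i, (g i).natDegree ≤ p ^ 2) →
        (∑ i, (g i).support.card) ^ 4 ≤ p ^ 3 →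
        (∑ i, C (c i) * g i ^ 2) = (feketePolynomial p).map (Int.castRingHom ℂ) →
        ∃ (K : Type) (_ : Field K) (_ : CharP K p) (d : ℕ) (c' : Fin d → K) (g' : Fin d → K[X]),
          d ≤ A ∧ (∀ j, (g' j).natDegree < p) ∧
          (∑ j, (g' j).support.card) ≤ A * ∑ i, (g i).support.card ∧
          (X ^ p - 1 : K[X]) ∣ (∑ j, C (c' j) * g' j ^ 2) - (feketePolynomial p).map (Int.castRingHom K) := by
  intro s
  obtain ⟨D, Cs, hA⟩ := nonCancellingReduction s
  refine ⟨(D + 1) * (2 * Cs + 1), 3, ?_⟩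
  intro p _ hp c g hdeg _hcheap hrep
  have hprime : p.Prime := Fact.out
  have hp2 : p ≠ 2 := by omega
  obtain ⟨K, iF, iC, iA, d, w, T, u, hdD, hu, hsupp, hdivA⟩ := hA p hp2 c g hdeg hrep
  obtain ⟨t, A, B, ht, hdegAB, hsuppAB, hdivB⟩ := stub_wittFold K p hp2 d w T
  set F : K[X] := (feketePolynomial p).map (Int.castRingHom K) with hF
  obtain ⟨W, hW⟩ : ∃ W : ℕ, W = ∑ j, (w j).support.card := ⟨_, rfl⟩
  obtain ⟨G, hG⟩ : ∃ G : ℕ, G = ∑ i, (g i).support.card := ⟨_, rfl⟩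
  rw [← hW, ← hG] at hsupp
  simp only [← hW] at hsuppAB
  rw [← hG]
  -- `4 ≠ 0` in characteristic `p ≥ 3`
  have h2 : (2 : K) ≠ 0 := by
    intro h
    have h' : ((2 : ℕ) : K) = 0 := by exact_mod_cast h
    rw [CharP.cast_eq_zero_iff K p] at h'
    exact hp2 ((Nat.prime_dvd_prime_iff_eq hprime Nat.prime_two).mp h')
  have h4 : (4 : K) ≠ 0 := by
    rw [show (4 : K) = 2 * 2 by norm_num]
    exact mul_ne_zero h2 h2
  refine ⟨K, iF, iC, t + t,
    Fin.append (fun _ : Fin t => u⁻¹ * 4⁻¹) (fun _ : Fin t => -(u⁻¹ * 4⁻¹)),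
    Fin.append (fun l => A l + B l) (fun l => A l - B l), ?_, ?_, ?_, ?_⟩
  · -- number of squares
    have : t + t ≤ D + 1 := by omega
    calc t + t ≤ D + 1 := this
      _ = (D + 1) * 1 := (mul_one _).symm
      _ ≤ (D + 1) * (2 * Cs + 1) := Nat.mul_le_mul_left _ (by omega)
  · -- degrees
    intro j
    refine Fin.addCases (fun l => ?_) (fun l => ?_) j
    · rw [Fin.append_left]
      exact lt_of_le_of_lt (natDegree_add_le _ _) (max_lt (hdegAB l).1 (hdegAB l).2)
    · rw [Fin.append_right]
      exact lt_of_le_of_lt (natDegree_sub_le _ _) (max_lt (hdegAB l).1 (hdegAB l).2)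
  · -- supports
    have hadd : ∀ l, (A l + B l).support.card ≤ 2 * W := fun l =>
      (Finset.card_le_card support_add).trans ((Finset.card_union_le _ _).trans (by have := hsuppAB l; omega))
    have hsub : ∀ l, (A l - B l).support.card ≤ 2 * W := fun l => by
      rw [sub_eq_add_neg]
      refine (Finset.card_le_card support_add).trans ((Finset.card_union_le _ _).trans ?_)
      rw [support_neg]; have := hsuppAB l; omega
    rw [Fin.sum_univ_add]
    simp only [Fin.append_left, Fin.append_right]
    calc ∑ l, (A l + B l).support.card + ∑ l, (A l - B l).support.card
        ≤ ∑ _l : Fin t, 2 * W + ∑ _l : Fin t, 2 * W :=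
          Nat.add_le_add (Finset.sum_le_sum fun l _ => hadd l) (Finset.sum_le_sum fun l _ => hsub l)
      _ = (t + t) * (2 * W) := by
          rw [Finset.sum_const, Finset.card_univ, Fintype.card_fin, smul_eq_mul]; ring
      _ ≤ (D + 1) * (2 * (Cs * G)) := Nat.mul_le_mul (by omega) (Nat.mul_le_mul_left 2 hsupp)
      _ ≤ (D + 1) * (2 * Cs + 1) * G := by nlinarith [Nat.zero_le G, Nat.zero_le D, Nat.zero_le Cs]
  · -- the identity, divided by `u`
    rw [sum_mul_eq_sum_append_sq h4 A B u⁻¹]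
    have hdivS : (X ^ p - 1 : K[X]) ∣ (∑ l, A l * B l) - C u * F := by
      have h := dvd_sub hdivA hdivB
      have e : (∑ j, ∑ j', C (T j j') * (w j * w j')) - C u * F - ((∑ j, ∑ j', C (T j j') * (w j * w j')) - ∑ l, A l * B l)
          = (∑ l, A l * B l) - C u * F := by ring
      rwa [e] at h
    have h := dvd_mul_of_dvd_right hdivS (C u⁻¹)
    have e : C u⁻¹ * ((∑ l, A l * B l) - C u * F) = C u⁻¹ * (∑ l, A l * B l) - F := by
      rw [mul_sub, ← mul_assoc, ← map_mul, inv_mul_cancel₀ hu, map_one, one_mul]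
    rwa [e] at h

/-- **D′ + B ⟹ D″ with `δ = 1/8`**: over the algebraic closure, a representation by `d ≤ s₁` squares is Witt-paired
(`stub_wittFold` ✓) into `t ≤ (d+1)/2 ≤ s₁` products with factors of support `≤ Σ|supp g_j|`; `stub_productGap` then gives
`p³ ≤ (C₀·(s₁+1)·Σ|supp g_j|)⁴`, i.e. `Σ|supp g_j| ≥ p^{3/4}/M ≥ p^{5/8}` for `p ≥ M⁸`, `M = C₀(s₁+1) + 3`. -/
theorem charPSparseSOSBounded_of_line :
    ∀ s₁ : ℕ, ∃ δ : ℝ, 0 < δ ∧ ∃ p₀ : ℕ, ∀ (p : ℕ) [Fact p.Prime], p₀ ≤ p →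
      ∀ (K : Type) [Field K] [CharP K p] (d : ℕ), d ≤ s₁ → ∀ (c : Fin d → K) (g : Fin d → K[X]),
        (∀ j, (g j).natDegree < p) →
        (X ^ p - 1 : K[X]) ∣ (∑ j, C (c j) * g j ^ 2) - (feketePolynomial p).map (Int.castRingHom K) →
        (p : ℝ) ^ (1 / 2 + δ) ≤ ∑ j, ((g j).support.card : ℝ) := by
  intro s₁
  obtain ⟨C₀, hD⟩ := stub_productGap s₁
  obtain ⟨M, hM⟩ : ∃ M : ℕ, M = C₀ * (s₁ + 1) + 3 := ⟨_, rfl⟩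
  refine ⟨1 / 8, by norm_num, M ^ 8, ?_⟩
  intro p _ hp K _ _ d hd c g hdeg hdvd
  have hprime : p.Prime := Fact.out
  have hMp : M ≤ p := (Nat.le_self_pow (by norm_num) M).trans hp
  have hp2 : p ≠ 2 := by omega
  -- base change to the algebraic closure
  let L := AlgebraicClosure K
  set φ : K →+* L := algebraMap K L with hφ
  have hφinj : Function.Injective φ := φ.injective
  haveI : CharP L p := charP_of_injective_algebraMap hφinj p
  set gL : Fin d → L[X] := fun j => (g j).map φ with hgL
  set FK : K[X] := (feketePolynomial p).map (Int.castRingHom K) with hFK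
  set FL : L[X] := (feketePolynomial p).map (Int.castRingHom L) with hFL
  have hFKL : FK.map φ = FL := by
    rw [hFK, Polynomial.map_map, RingHom.ext_int (φ.comp (Int.castRingHom K)) (Int.castRingHom L)]
  have hdvdL : (X ^ p - 1 : L[X]) ∣ (∑ j, C (φ (c j)) * gL j ^ 2) - FL := by
    have h := map_dvd (mapRingHom φ) hdvd
    simp only [coe_mapRingHom, Polynomial.map_sub, Polynomial.map_pow, Polynomial.map_X, Polynomial.map_one,
      Polynomial.map_sum, Polynomial.map_mul, map_C] at h
    rwa [hFKL] at h
  have hdegL : ∀ j, (gL j).natDegree < p := fun j => by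
    rw [hgL]; dsimp only; rw [natDegree_map_eq_of_injective hφinj]; exact hdeg j
  have hsuppL : ∀ j, (gL j).support = (g j).support := fun j => support_map_of_injective _ hφinj
  -- Witt-pair over `L`
  obtain ⟨t, A, B, ht, hdegAB, hsuppAB, hdivB⟩ := stub_wittFold L p hp2 d gL (Matrix.diagonal fun j => φ (c j))
  rw [sum_sum_diagonal_eq] at hdivB
  have htS : t ≤ s₁ := by omega
  have hdivS : (X ^ p - 1 : L[X]) ∣ (∑ l, A l * B l) - C 1 * FL := by
    have h := dvd_sub hdvdL hdivB
    have e : (∑ j, C (φ (c j)) * gL j ^ 2) - FL - ((∑ j, C (φ (c j)) * gL j ^ 2) - ∑ l, A l * B l)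
        = (∑ l, A l * B l) - C 1 * FL := by rw [map_one, one_mul]; ring
    rwa [e] at h
  have hgap := hD L p t htS A B 1 one_ne_zero hdegAB hdivS
  -- support bookkeeping: everything in terms of `W = Σ |supp g_j|`
  set W : ℕ := ∑ j, (g j).support.card with hW
  have hWL : (∑ j, (gL j).support.card) = W := by
    rw [hW]; exact Finset.sum_congr rfl fun j _ => by rw [hsuppL j]
  have hT : ∑ l, ((A l).support.card + (B l).support.card) ≤ t * (2 * W) := by
    calc ∑ l, ((A l).support.card + (B l).support.card) ≤ ∑ _l : Fin t, (2 * W) :=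
          Finset.sum_le_sum fun l _ => by have h := hsuppAB l; rw [hWL] at h; omega
      _ = t * (2 * W) := by rw [Finset.sum_const, Finset.card_univ, Fintype.card_fin, smul_eq_mul]
  have hkey : C₀ * ∑ l, ((A l).support.card + (B l).support.card) ≤ M * W := by
    calc C₀ * ∑ l, ((A l).support.card + (B l).support.card) ≤ C₀ * (t * (2 * W)) := by gcongr
      _ ≤ C₀ * ((s₁ + 1) * W) := by
          apply Nat.mul_le_mul_left; have : t * 2 ≤ s₁ + 1 := by omega
          calc t * (2 * W) = (t * 2) * W := by ring
            _ ≤ (s₁ + 1) * W := Nat.mul_le_mul_right W this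
      _ = (C₀ * (s₁ + 1)) * W := by ring
      _ ≤ M * W := Nat.mul_le_mul_right W (by omega)
  have hp3 : p ^ 3 ≤ (M * W) ^ 4 := hgap.trans (Nat.pow_le_pow_left hkey 4)
  -- real arithmetic (as in the products composition): `p^(5/8) ≤ p^(3/4)/M ≤ W`
  have hexp : (1 / 2 + 1 / 8 : ℝ) = 5 / 8 := by norm_num
  rw [hexp]
  have hWreal : ((W : ℕ) : ℝ) = ∑ j, ((g j).support.card : ℝ) := by rw [hW, Nat.cast_sum]
  rw [← hWreal]
  have hM0 : (0 : ℝ) < (M : ℝ) := Nat.cast_pos.mpr (by omega)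
  have hp_pos : (0 : ℝ) < (p : ℝ) := Nat.cast_pos.mpr hprime.pos
  have hW0 : (0 : ℝ) ≤ (W : ℝ) := Nat.cast_nonneg W
  have hpR : (M : ℝ) ^ (8 : ℕ) ≤ (p : ℝ) := by
    have h := (Nat.cast_le (α := ℝ)).mpr hp
    rwa [Nat.cast_pow] at h
  have hp3R : (p : ℝ) ^ (3 : ℕ) ≤ ((M : ℝ) * (W : ℝ)) ^ (4 : ℕ) := by
    have h := (Nat.cast_le (α := ℝ)).mpr hp3
    rwa [Nat.cast_pow, Nat.cast_pow, Nat.cast_mul] at h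
  have hroot : (M : ℝ) ≤ (p : ℝ) ^ (1 / 8 : ℝ) := by
    have h1 : ((M : ℝ) ^ (8 : ℕ)) ^ (1 / 8 : ℝ) = M := by
      rw [show (1 / 8 : ℝ) = ((8 : ℕ) : ℝ)⁻¹ by norm_num]
      exact Real.pow_rpow_inv_natCast hM0.le (by norm_num)
    rw [← h1]
    exact Real.rpow_le_rpow (pow_nonneg hM0.le 8) hpR (by norm_num)
  have h34 : (p : ℝ) ^ (3 / 4 : ℝ) ≤ (M : ℝ) * (W : ℝ) := by
    have hMW0 : (0 : ℝ) ≤ (M : ℝ) * (W : ℝ) := mul_nonneg hM0.le hW0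
    have h1 : (((M : ℝ) * (W : ℝ)) ^ (4 : ℕ)) ^ (1 / 4 : ℝ) = (M : ℝ) * (W : ℝ) := by
      rw [show (1 / 4 : ℝ) = ((4 : ℕ) : ℝ)⁻¹ by norm_num]
      exact Real.pow_rpow_inv_natCast hMW0 (by norm_num)
    have h2 : ((p : ℝ) ^ (3 : ℕ)) ^ (1 / 4 : ℝ) = (p : ℝ) ^ (3 / 4 : ℝ) := by
      rw [← Real.rpow_natCast (p : ℝ) 3, ← Real.rpow_mul hp_pos.le]
      rw [show ((3 : ℕ) : ℝ) * (1 / 4 : ℝ) = 3 / 4 by norm_num]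
    rw [← h2, ← h1]
    exact Real.rpow_le_rpow (pow_nonneg hp_pos.le 3) hp3R (by norm_num)
  have hsplit : (p : ℝ) ^ (5 / 8 : ℝ) * (p : ℝ) ^ (1 / 8 : ℝ) = (p : ℝ) ^ (3 / 4 : ℝ) := by
    rw [← Real.rpow_add hp_pos]
    rw [show (5 / 8 : ℝ) + 1 / 8 = 3 / 4 by norm_num]
  have hnn : 0 ≤ (p : ℝ) ^ (5 / 8 : ℝ) := Real.rpow_nonneg hp_pos.le _
  have hmain : (p : ℝ) ^ (5 / 8 : ℝ) * (M : ℝ) ≤ (W : ℝ) * (M : ℝ) := by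
    calc (p : ℝ) ^ (5 / 8 : ℝ) * (M : ℝ) ≤ (p : ℝ) ^ (5 / 8 : ℝ) * (p : ℝ) ^ (1 / 8 : ℝ) :=
          mul_le_mul_of_nonneg_left hroot hnn
      _ = (p : ℝ) ^ (3 / 4 : ℝ) := hsplit
      _ ≤ (M : ℝ) * (W : ℝ) := h34
      _ = (W : ℝ) * (M : ℝ) := mul_comm _ _
  exact le_of_mul_le_mul_right hmain hM0

/-! ## The products route (alternative composition of reshape r2, kept: A0 + A1 + B + D′ ⟹ crux) -/


/-- **The crux via the PRODUCTS route** (alternative composition, lead reshape r2: via the glue `nonCancellingReduction` = A0 + A1,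
then B = `stub_wittFold`, then D′ = `stub_productGap`; direct style, as the skeleton audit requires: the theorem
concludes `FeketeSOS.FeketeBoundedFanin` BY NAME and takes no hypotheses; `sorry` occurs only inside the `stub_*` it
calls).  Constants: `k = 2·C₀(D)·D·C(s₀)`, `M = k + 3`, `δ = 1/8`, `p₀ = M⁸`.  For `p ≥ p₀`: reduce (A), pair and
fold (B), so that `X^p − 1 ∣ Σ_l Ã_l B̃_l − u·F̄_p` with `u ≠ 0`, `t ≤ D` products of degree `< p` and total support
`≤ 2t·C(s₀)·G`, `G = Σ|supp g_i|`; (D′) gives `p³ ≤ (C₀·2t·C(s₀)·G)⁴ ≤ (M·G)⁴`, i.e. `p^{3/4} ≤ M·G`, and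
`p^{5/8} = p^{3/4}/p^{1/8} ≤ p^{3/4}/M ≤ G`. -/
theorem FeketeBoundedFanin_of_products : FeketeSOS.FeketeBoundedFanin := by
  have hA := nonCancellingReduction
  have hB := stub_wittFold
  have hD := stub_productGap
  intro s₀
  -- constants of the line at fan-in `s₀`
  obtain ⟨D, Cs, hA⟩ := hA s₀
  obtain ⟨C₀, hD⟩ := hD D
  obtain ⟨k, hk⟩ : ∃ k : ℕ, k = C₀ * (D * (2 * Cs)) := ⟨_, rfl⟩
  obtain ⟨M, hM⟩ : ∃ M : ℕ, M = k + 3 := ⟨_, rfl⟩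
  have hM3 : 3 ≤ M := by omega
  refine ⟨1 / 8, by norm_num, M ^ 8, ?_⟩
  intro p _ hp c g hdeg hrep
  have hprime : p.Prime := Fact.out
  have hMp : M ≤ p := (Nat.le_self_pow (by norm_num) M).trans hp
  have hp2 : p ≠ 2 := by omega
  -- (A) reduce to a non-cancelling characteristic-`p` quadratic identity
  have hrep' : (∑ i, C (c i) * g i ^ 2) = (feketePolynomial p).map (Int.castRingHom ℂ) :=
    hrep.trans (map_feketePolynomial_complex p).symm
  obtain ⟨K, iF, iC, iA, d, w, T, u, hdD, hu, hsupp, hdivA⟩ := hA p hp2 c g hdeg hrep'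
  -- (B) Witt-pair and fold
  obtain ⟨t, A, B, ht, hdegAB, hsuppAB, hdivB⟩ := hB K p hp2 d w T
  have htD : t ≤ D := by omega
  set F : K[X] := (feketePolynomial p).map (Int.castRingHom K) with hF
  set S : K[X] := ∑ l, A l * B l with hS
  have hdivS : (X ^ p - 1 : K[X]) ∣ S - C u * F := by
    have h := dvd_sub hdivA hdivB
    have e : (∑ j, ∑ j', C (T j j') * (w j * w j')) - C u * F - ((∑ j, ∑ j', C (T j j') * (w j * w j')) - S)
        = S - C u * F := by ring
    rwa [e] at h
  -- (D′) the product gap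
  have hgap := hD K p t htD A B u hu hdegAB hdivS
  -- support bookkeeping
  set W : ℕ := ∑ j, (w j).support.card with hW
  set G : ℕ := ∑ i, (g i).support.card with hG
  have hT : ∑ l, ((A l).support.card + (B l).support.card) ≤ t * (2 * W) := by
    calc ∑ l, ((A l).support.card + (B l).support.card) ≤ ∑ l : Fin t, (2 * W) :=
          Finset.sum_le_sum fun l _ => by have h := hsuppAB l; omega
      _ = t * (2 * W) := by
          rw [Finset.sum_const, Finset.card_univ, Fintype.card_fin, smul_eq_mul]
  have hkey : C₀ * ∑ l, ((A l).support.card + (B l).support.card) ≤ M * G := by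
    calc C₀ * ∑ l, ((A l).support.card + (B l).support.card) ≤ C₀ * (t * (2 * W)) := by gcongr
      _ ≤ C₀ * (D * (2 * (Cs * G))) := by gcongr
      _ = k * G := by rw [hk]; ring
      _ ≤ M * G := Nat.mul_le_mul_right G (by omega)
  have hp3 : p ^ 3 ≤ (M * G) ^ 4 := hgap.trans (Nat.pow_le_pow_left hkey 4)
  -- real arithmetic: `p^(5/8) ≤ p^(3/4) / M ≤ G`
  have hexp : (1 / 2 + 1 / 8 : ℝ) = 5 / 8 := by norm_num
  rw [hexp]
  have hGreal : ((G : ℕ) : ℝ) = ∑ i, ((g i).support.card : ℝ) := by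
    rw [hG, Nat.cast_sum]
  rw [← hGreal]
  -- plain real versions of the natural-number facts
  have hM0 : (0 : ℝ) < (M : ℝ) := Nat.cast_pos.mpr (by omega)
  have hp_pos : (0 : ℝ) < (p : ℝ) := Nat.cast_pos.mpr hprime.pos
  have hG0 : (0 : ℝ) ≤ (G : ℝ) := Nat.cast_nonneg G
  have hpR : (M : ℝ) ^ (8 : ℕ) ≤ (p : ℝ) := by
    have h := (Nat.cast_le (α := ℝ)).mpr hp
    rwa [Nat.cast_pow] at h
  have hp3R : (p : ℝ) ^ (3 : ℕ) ≤ ((M : ℝ) * (G : ℝ)) ^ (4 : ℕ) := by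
    have h := (Nat.cast_le (α := ℝ)).mpr hp3
    rwa [Nat.cast_pow, Nat.cast_pow, Nat.cast_mul] at h
  have hroot : (M : ℝ) ≤ (p : ℝ) ^ (1 / 8 : ℝ) := by
    have h1 : ((M : ℝ) ^ (8 : ℕ)) ^ (1 / 8 : ℝ) = M := by
      rw [show (1 / 8 : ℝ) = ((8 : ℕ) : ℝ)⁻¹ by norm_num]
      exact Real.pow_rpow_inv_natCast hM0.le (by norm_num)
    rw [← h1]
    exact Real.rpow_le_rpow (pow_nonneg hM0.le 8) hpR (by norm_num)
  have h34 : (p : ℝ) ^ (3 / 4 : ℝ) ≤ (M : ℝ) * (G : ℝ) := by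
    have hMG0 : (0 : ℝ) ≤ (M : ℝ) * (G : ℝ) := mul_nonneg hM0.le hG0
    have h1 : (((M : ℝ) * (G : ℝ)) ^ (4 : ℕ)) ^ (1 / 4 : ℝ) = (M : ℝ) * (G : ℝ) := by
      rw [show (1 / 4 : ℝ) = ((4 : ℕ) : ℝ)⁻¹ by norm_num]
      exact Real.pow_rpow_inv_natCast hMG0 (by norm_num)
    have h2 : ((p : ℝ) ^ (3 : ℕ)) ^ (1 / 4 : ℝ) = (p : ℝ) ^ (3 / 4 : ℝ) := by
      rw [← Real.rpow_natCast (p : ℝ) 3, ← Real.rpow_mul hp_pos.le]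
      rw [show ((3 : ℕ) : ℝ) * (1 / 4 : ℝ) = 3 / 4 by norm_num]
    rw [← h2, ← h1]
    exact Real.rpow_le_rpow (pow_nonneg hp_pos.le 3) hp3R (by norm_num)
  have hsplit : (p : ℝ) ^ (5 / 8 : ℝ) * (p : ℝ) ^ (1 / 8 : ℝ) = (p : ℝ) ^ (3 / 4 : ℝ) := by
    rw [← Real.rpow_add hp_pos]
    rw [show (5 / 8 : ℝ) + 1 / 8 = 3 / 4 by norm_num]
  have hnn : 0 ≤ (p : ℝ) ^ (5 / 8 : ℝ) := Real.rpow_nonneg hp_pos.le _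
  have hmain : (p : ℝ) ^ (5 / 8 : ℝ) * (M : ℝ) ≤ (G : ℝ) * (M : ℝ) := by
    calc (p : ℝ) ^ (5 / 8 : ℝ) * (M : ℝ) ≤ (p : ℝ) ^ (5 / 8 : ℝ) * (p : ℝ) ^ (1 / 8 : ℝ) :=
          mul_le_mul_of_nonneg_left hroot hnn
      _ = (p : ℝ) ^ (3 / 4 : ℝ) := hsplit
      _ ≤ (M : ℝ) * (G : ℝ) := h34
      _ = (G : ℝ) * (M : ℝ) := mul_comm _ _
  exact le_of_mul_le_mul_right hmain hM0

/-- The crux, by its conventional closing name (main composition). -/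
theorem FeketeBoundedFanin_proof : FeketeSOS.FeketeBoundedFanin := FeketeBoundedFanin_of

end Summit.ValiantsHypothesis.ValiantsHypothesis.Cruxes.FeketeBoundedFanin.WittPascalUfa
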